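import Literature.Topology.Immersions.NormalProjBundle
import Mathlib.Analysis.Normed.Operator.Bilinear
import HarnessLib

/-!
# Small linear perturbations of an immersion keep it an immersion and keep its normal bundle

Topic `Literature/Topology/Immersions`. Quantitative stability for the linear perturbation
families `f + Λ ∘ ρ` of `DoublePointsGenericity.lean` / `GenericImmersionPerturbation.lean`
(Hirsch, *Differential Topology* (1976), Ch. 2 §1, Thm. 1.1 and Lemma 1.3: immersions are open;
Milnor–Stasheff (1974), §3: the normal bundle of an immersion): for a `C^∞` immersion
`f : M → ℝ^q` of a **compact** manifold and any `C^∞` `ρ : M → ℝᴷ` there is `ε > 0` such that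
for every linear `Λ : ℝᴷ →L ℝ^q` with `‖Λ‖ < ε`

* `f + Λ ∘ ρ` is an immersion, and
* its normal projections are uniformly close to those of `f`:
  `‖(1 - P^{tan}_f(x)) - (1 - P^{tan}_{f + Λρ}(x))‖ < 1` for all `x`

(`exists_pos_forall_injective_mfderiv_and_norm_normalProj_sub_lt`), so that (by
`ProjBundle.isIso_proj_of_norm_sub_lt_one`, `ProjBundleIso.lean`) **the normal bundles of `f` and
of `f + Λ ∘ ρ` are isomorphic** (`exists_pos_forall_isIso_normal`-type corollaries are left to
the user, who holds the immersion proofs as data of `ProjBundle.normal`).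

Proof: in the chart at `p` the tangent projection of `e` at `x` is `gramProj (D(e ∘ φₚ⁻¹)(φₚ x))`
(`Literature.Topology.FourManifolds.tangentProj_eq_gramProj_chartDeriv`), the chart derivative
of `f + Λ ∘ ρ` is `A_x + Λ ∘ B_x` with `A, B` the chart derivatives of `f, ρ` (continuous in `x`),
`gramProj` is continuous at injective arguments (`contDiffAt_gramProj`), injectivity is open
(Mathlib's `ContinuousLinearMap.isOpen_injective`), and
a tube-lemma / finite-cover argument on compact chart neighbourhoods gives a uniform `ε`.

Everything here is proved; no definitions, no named facts.

## References

* M. W. Hirsch, *Differential Topology*, GTM 33 (1976), Ch. 2 §1, Thm. 1.1, Lemma 1.3.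
  [HirschDT1976]
* J. Milnor, J. Stasheff, *Characteristic Classes* (1974), §3. [MilnorStasheff1974]
-/

open scoped Manifold ContDiff Topology
open Set Function Module Metric Filter

noncomputable section

namespace Literature.Topology.Immersions

/-- Local notation: `𝔼 n` is the model Euclidean space `EuclideanSpace ℝ (Fin n)`. -/
local notation "𝔼 " n:arg => EuclideanSpace ℝ (Fin n)

open Literature.Topology.FourManifolds (tangentProj chartDeriv gramProj contDiffAt_gramProj
  tangentProj_eq_gramProj_chartDeriv injective_chartDeriv mfderiv_eq_chartDeriv_comp
  contDiffOn_chartDeriv hasFDerivAt_comp_extChartAt_symm)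

variable {n q K : ℕ} {M : Type*} [TopologicalSpace M] [ChartedSpace (𝔼 n) M]
  [IsManifold (𝓡 n) ∞ M]

/-! ### Chart derivatives

(Openness of injectivity for linear maps out of `ℝⁿ` is Mathlib's
`ContinuousLinearMap.isOpen_injective`, used directly in the stability theorem below.) -/

/-- **The chart derivative of `f + Λ ∘ ρ`** is `A + Λ ∘ B` on the chart target. [folklore] -/
theorem chartDeriv_add_clm_comp {f : M → 𝔼 q} (hf : ContMDiff (𝓡 n) (𝓡 q) ∞ f)
    {ρ : M → 𝔼 K} (hρ : ContMDiff (𝓡 n) (𝓡 K) ∞ ρ) (Λ : 𝔼 K →L[ℝ] 𝔼 q) (p : M) {y : 𝔼 n}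
    (hy : y ∈ (extChartAt (𝓡 n) p).target) :
    chartDeriv (𝓡 n) (fun z => f z + Λ (ρ z)) p y =
      chartDeriv (𝓡 n) f p y + Λ.comp (chartDeriv (𝓡 n) ρ p y) := by
  have h1 := hasFDerivAt_comp_extChartAt_symm (I := 𝓡 n) hf p hy
  have h2 := hasFDerivAt_comp_extChartAt_symm (I := 𝓡 n) hρ p hy
  have h3 : HasFDerivAt ((fun z => f z + Λ (ρ z)) ∘ (extChartAt (𝓡 n) p).symm)
      (chartDeriv (𝓡 n) f p y + Λ.comp (chartDeriv (𝓡 n) ρ p y)) y :=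
    h1.add (Λ.hasFDerivAt.comp y h2)
  exact h3.fderiv

/-- In the chart at `p`, `d e_x` is injective iff the chart derivative at `φₚ x` is.
[folklore] -/
theorem injective_mfderiv_iff_injective_chartDeriv {e : M → 𝔼 q}
    (he : ContMDiff (𝓡 n) (𝓡 q) ∞ e) (p : M) {x : M} (hx : x ∈ (extChartAt (𝓡 n) p).source) :
    Injective (mfderiv (𝓡 n) (𝓡 q) e x) ↔
      Injective (chartDeriv (𝓡 n) e p (extChartAt (𝓡 n) p x)) := by
  have hed : MDifferentiableAt (𝓡 n) (𝓡 q) e x := (he x).mdifferentiableAt (by simp)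
  have heq := mfderiv_eq_chartDeriv_comp (I := 𝓡 n) hx hed
  have hinv := isInvertible_mfderiv_extChartAt (I := 𝓡 n) hx
  have hfun : (mfderiv (𝓡 n) (𝓡 q) e x : 𝔼 n → 𝔼 q) =
      chartDeriv (𝓡 n) e p (extChartAt (𝓡 n) p x) ∘
        mfderiv (𝓡 n) 𝓘(ℝ, 𝔼 n) (extChartAt (𝓡 n) p) x := by
    rw [heq]
    rfl
  rw [hfun]
  constructor
  · intro h
    exact Injective.of_comp_right h hinv.surjective
  · intro h
    exact h.comp hinv.injective

/-! ### The stability theorem -/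

/-- **Small linear perturbations keep an immersion an immersion with a nearby normal bundle.**
For a `C^∞` immersion `f : M → ℝ^q` of a compact manifold and a `C^∞` map `ρ : M → ℝᴷ` there
is `ε > 0` such that for every `Λ : ℝᴷ →L ℝ^q` with `‖Λ‖ < ε` the map `f + Λ ∘ ρ` has
everywhere injective differential and `‖(normal projection of f at x) - (that of f + Λ ∘ ρ)‖ < 1`
for all `x`. [cite: HirschDT1976, Ch. 2 §1 Thm. 1.1; MilnorStasheff1974, §3] -/
theorem exists_pos_forall_injective_mfderiv_and_norm_normalProj_sub_lt [T2Space M] [CompactSpace M]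
    {f : M → 𝔼 q} (hf : ContMDiff (𝓡 n) (𝓡 q) ∞ f)
    (himm : ∀ x, Injective (mfderiv (𝓡 n) (𝓡 q) f x))
    {ρ : M → 𝔼 K} (hρ : ContMDiff (𝓡 n) (𝓡 K) ∞ ρ) :
    ∃ ε > 0, ∀ Λ : 𝔼 K →L[ℝ] 𝔼 q, ‖Λ‖ < ε → ∀ x,
      Injective (mfderiv (𝓡 n) (𝓡 q) (fun z => f z + Λ (ρ z)) x) ∧
      ‖ProjBundle.normalProj n f x - ProjBundle.normalProj n (fun z => f z + Λ (ρ z)) x‖ < 1 := by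
  haveI : LocallyCompactSpace M := ChartedSpace.locallyCompactSpace (𝔼 n) M
  -- chart derivatives of `f`, `ρ` at the base point `p`, read at `x`
  let A : M → M → (𝔼 n →L[ℝ] 𝔼 q) := fun p x => chartDeriv (𝓡 n) f p (extChartAt (𝓡 n) p x)
  let B : M → M → (𝔼 n →L[ℝ] 𝔼 K) := fun p x => chartDeriv (𝓡 n) ρ p (extChartAt (𝓡 n) p x)
  let G : M → M × (𝔼 K →L[ℝ] 𝔼 q) → (𝔼 n →L[ℝ] 𝔼 q) := fun p z => A p z.1 + z.2.comp (B p z.1)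
  have hAc : ∀ p, ContinuousOn (A p) (extChartAt (𝓡 n) p).source := fun p =>
    (contDiffOn_chartDeriv (I := 𝓡 n) hf p).continuousOn.comp (continuousOn_extChartAt p)
      fun x hx => (extChartAt (𝓡 n) p).map_source hx
  have hBc : ∀ p, ContinuousOn (B p) (extChartAt (𝓡 n) p).source := fun p =>
    (contDiffOn_chartDeriv (I := 𝓡 n) hρ p).continuousOn.comp (continuousOn_extChartAt p)
      fun x hx => (extChartAt (𝓡 n) p).map_source hx
  have hGc : ∀ p, ContinuousOn (G p) ((extChartAt (𝓡 n) p).source ×ˢ univ) := fun p =>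
    ((hAc p).comp continuousOn_fst fun z hz => hz.1).add
      (continuousOn_snd.clm_comp ((hBc p).comp continuousOn_fst fun z hz => hz.1))
  have hfd : ∀ x, MDifferentiableAt (𝓡 n) (𝓡 q) f x := fun x => (hf x).mdifferentiableAt (by simp)
  have hinjA : ∀ p, ∀ x ∈ (extChartAt (𝓡 n) p).source, Injective (A p x) := fun p x hx =>
    injective_chartDeriv (I := 𝓡 n) hx (hfd x) (himm x)
  have hG0 : ∀ p x, G p (x, 0) = A p x := fun p x => by
    show A p x + (0 : 𝔼 K →L[ℝ] 𝔼 q).comp (B p x) = A p x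
    rw [ContinuousLinearMap.zero_comp, add_zero]
  -- Step 1: local radii on compact chart neighbourhoods
  have step : ∀ p : M, ∃ C : Set M, C ∈ 𝓝 p ∧ C ⊆ (extChartAt (𝓡 n) p).source ∧
      ∃ ε > 0, ∀ Λ : 𝔼 K →L[ℝ] 𝔼 q, ‖Λ‖ < ε → ∀ x ∈ C,
        Injective (G p (x, Λ)) ∧ ‖gramProj (G p (x, 0)) - gramProj (G p (x, Λ))‖ < 1 := by
    intro p
    obtain ⟨C, hC, hCsub, hCc⟩ :=
      local_compact_nhds ((isOpen_extChartAt_source (I := 𝓡 n) p).mem_nhds (mem_extChartAt_source p))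
    refine ⟨C, hC, hCsub, ?_⟩
    -- the open set where `G` is injective, and the deviation of the projections on it
    have hU : IsOpen (((extChartAt (𝓡 n) p).source ×ˢ (univ : Set (𝔼 K →L[ℝ] 𝔼 q))) ∩
        G p ⁻¹' {L | Injective L}) :=
      (hGc p).isOpen_inter_preimage ((isOpen_extChartAt_source p).prod isOpen_univ)
        ContinuousLinearMap.isOpen_injective
    have hΨ : ContinuousOn (fun z : M × (𝔼 K →L[ℝ] 𝔼 q) =>
        ‖gramProj (G p (z.1, 0)) - gramProj (G p z)‖)
        ((((extChartAt (𝓡 n) p).source ×ˢ univ) ∩ G p ⁻¹' {L | Injective L})) := by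
      refine ContinuousOn.norm (ContinuousOn.sub ?_ ?_)
      · have h1 : ContinuousOn (fun z : M × (𝔼 K →L[ℝ] 𝔼 q) => gramProj (A p z.1))
            ((((extChartAt (𝓡 n) p).source ×ˢ univ) ∩ G p ⁻¹' {L | Injective L})) := by
          intro z hz
          have hw : ContinuousWithinAt (fun z : M × (𝔼 K →L[ℝ] 𝔼 q) => A p z.1)
              ((((extChartAt (𝓡 n) p).source ×ˢ univ) ∩ G p ⁻¹' {L | Injective L})) z :=
            (((hAc p).comp continuousOn_fst fun z hz => hz.1).mono inter_subset_left) z hz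
          exact ContinuousAt.comp_continuousWithinAt (f := fun z : M × (𝔼 K →L[ℝ] 𝔼 q) => A p z.1)
            (contDiffAt_gramProj (hinjA p z.1 hz.1.1)).continuousAt hw
        refine h1.congr fun z _ => ?_
        show gramProj (G p (z.1, 0)) = gramProj (A p z.1)
        rw [hG0]
      · intro z hz
        exact ContinuousAt.comp_continuousWithinAt (f := G p)
          (contDiffAt_gramProj hz.2).continuousAt (((hGc p).mono inter_subset_left) z hz)
    have hO : IsOpen ((((extChartAt (𝓡 n) p).source ×ˢ univ) ∩ G p ⁻¹' {L | Injective L}) ∩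
        (fun z : M × (𝔼 K →L[ℝ] 𝔼 q) => ‖gramProj (G p (z.1, 0)) - gramProj (G p z)‖) ⁻¹' Iio 1) :=
      hΨ.isOpen_inter_preimage hU isOpen_Iio
    have hsub : C ×ˢ ({0} : Set (𝔼 K →L[ℝ] 𝔼 q)) ⊆
        (((extChartAt (𝓡 n) p).source ×ˢ univ) ∩ G p ⁻¹' {L | Injective L}) ∩
          (fun z : M × (𝔼 K →L[ℝ] 𝔼 q) => ‖gramProj (G p (z.1, 0)) - gramProj (G p z)‖) ⁻¹' Iio 1 := by
      rintro ⟨x, Λ⟩ ⟨hx, hΛ⟩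
      have hΛ0 : Λ = 0 := hΛ
      subst hΛ0
      refine ⟨⟨⟨hCsub hx, mem_univ _⟩, ?_⟩, ?_⟩
      · show Injective (G p (x, 0))
        rw [hG0]
        exact hinjA p x (hCsub hx)
      · show ‖gramProj (G p (x, 0)) - gramProj (G p (x, 0))‖ < 1
        rw [sub_self, norm_zero]
        exact zero_lt_one
    obtain ⟨U', W, -, hWo, hKU, h0W, hUW⟩ := generalized_tube_lemma hCc isCompact_singleton hO hsub
    obtain ⟨ε, hε, hball⟩ := Metric.isOpen_iff.1 hWo 0 (h0W rfl)
    refine ⟨ε, hε, fun Λ hΛ x hx => ?_⟩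
    have hmem : ((x, Λ) : M × (𝔼 K →L[ℝ] 𝔼 q)) ∈ U' ×ˢ W :=
      ⟨hKU hx, hball (mem_ball_zero_iff.2 hΛ)⟩
    exact ⟨(hUW hmem).1.2, (hUW hmem).2⟩
  choose C hCn hCsub ε hε hgood using step
  -- Step 2: finitely many chart neighbourhoods cover `M`
  obtain ⟨t, ht⟩ := CompactSpace.elim_nhds_subcover C hCn
  classical
  obtain ⟨ε₀, hε₀, hε₀le⟩ : ∃ ε₀ > 0, ∀ p ∈ t, ε₀ ≤ ε p := by
    refine ⟨if ht' : t.Nonempty then t.inf' ht' ε else 1, ?_, fun p hp => ?_⟩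
    · split_ifs with ht'
      · obtain ⟨p, hp, hmin⟩ := Finset.exists_mem_eq_inf' ht' ε
        rw [hmin]
        exact hε p
      · exact one_pos
    · rw [dif_pos ⟨p, hp⟩]
      exact Finset.inf'_le _ hp
  refine ⟨ε₀, hε₀, fun Λ hΛ x => ?_⟩
  have hx : x ∈ ⋃ p ∈ t, C p := by rw [ht]; trivial
  obtain ⟨p, hp, hxC⟩ := mem_iUnion₂.1 hx
  have hxS : x ∈ (extChartAt (𝓡 n) p).source := hCsub p hxC
  obtain ⟨hinjG, hest⟩ := hgood p Λ (lt_of_lt_of_le hΛ (hε₀le p hp)) x hxC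
  -- the perturbed map and its chart derivative
  have hg : ContMDiff (𝓡 n) (𝓡 q) ∞ fun z => f z + Λ (ρ z) := hf.add (Λ.contDiff.comp_contMDiff hρ)
  have hcd : chartDeriv (𝓡 n) (fun z => f z + Λ (ρ z)) p (extChartAt (𝓡 n) p x) = G p (x, Λ) :=
    chartDeriv_add_clm_comp hf hρ Λ p ((extChartAt (𝓡 n) p).map_source hxS)
  have hinjg : Injective (mfderiv (𝓡 n) (𝓡 q) (fun z => f z + Λ (ρ z)) x) := by
    rw [injective_mfderiv_iff_injective_chartDeriv hg p hxS, hcd]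
    exact hinjG
  refine ⟨hinjg, ?_⟩
  -- the normal projections in the chart: `1 - gramProj (chart derivative)`
  have hTf : tangentProj (𝓡 n) f x = gramProj (A p x) :=
    tangentProj_eq_gramProj_chartDeriv (I := 𝓡 n) hxS (hfd x) (himm x)
  have hTg : tangentProj (𝓡 n) (fun z => f z + Λ (ρ z)) x = gramProj (G p (x, Λ)) := by
    rw [tangentProj_eq_gramProj_chartDeriv (I := 𝓡 n) hxS ((hg x).mdifferentiableAt (by simp)) hinjg, hcd]
  have heq : ProjBundle.normalProj n f x - ProjBundle.normalProj n (fun z => f z + Λ (ρ z)) x =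
      gramProj (G p (x, Λ)) - gramProj (G p (x, 0)) := by
    have h1 : ProjBundle.normalProj n f x = 1 - tangentProj (𝓡 n) f x :=
      congrFun (ProjBundle.normalProj_eq (n := n) f) x
    have h2 : ProjBundle.normalProj n (fun z => f z + Λ (ρ z)) x =
        1 - tangentProj (𝓡 n) (fun z => f z + Λ (ρ z)) x :=
      congrFun (ProjBundle.normalProj_eq (n := n) fun z => f z + Λ (ρ z)) x
    rw [h1, h2, hTf, hTg, hG0]
    abel
  rw [heq, norm_sub_rev]
  exact hest

end Literature.Topology.Immersions
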